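import Mathlib
import Literature.MathematicalPhysics.QuantumFieldTheory.QCDPhaseQuenchedReweighting
import Literature.MathematicalPhysics.QuantumLattice.LatticeGaugeDLRCovarianceSplit

/-!
# The QUENCHED END of the massive ray: `μ → ∞` of the honest lattice-QCD torus functional at fixed `(β, S)`
# (first brick of stub `stub_uniformlyMassiveAboveOfBody` (U), line `bounded_locator` rev 3, crux
# `EulerDescent.HonestHeavyAnchor`, item stmt-QuantumFields-16901)

Helper file (def-free, sorry-free) of the worker of stub U (lead prover-line-stmt-QuantumFields-16901-0, cycle 1,
wave 2).  The stub itself — "a mass-scaling, asymptotically scaling regularisation carrying the heavy QCD body admits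
`M'` such that, eventually in `k`, EVERY degenerate bare Wilson mass `μ ≥ m_crit(k) + a_k M'/Z_m(k)` is massive at the
regularisation's own (weak) coupling `β_k`, with one onset for all `μ` and all pairs of observables" — is open-problem
grade: at its `μ = +∞` end it is exponential clustering of lattice `SU(3)` Yang–Mills at FIXED WEAK `β` uniformly in
the volume, and below that a hopping (large-mass) expansion around `μ = ∞` uniform in the volume; neither is a published
theorem (the proved corner of the `(β, κ)` plane is small `β` AND small `κ`: the Osterwalder–Seiler 1978 strong-coupling
cluster expansion and its extension to matter fields — Montvay–Münster 1994 §3.7.1 p. 163, Meyer-Ortmanns–Reisz 2006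
§4.1.3 pp. 301–303 (polymer expansions for gauge fields with quark fields, small `β` and small hopping `K`) and §4.1.5
pp. 306–311 (the Osterwalder–Seiler theorem, uniform in the volume)).

What IS closed, and landed here, is the `μ = +∞` END POINT of the ray at fixed torus side `S` and fixed `β` — the
**quenched limit** of the honest signed functional `qcdTorusExpect` of `QCDOS.lean` on purely gluonic insertions:

* §1 `diracMatrix_mass_add`, `diracMatrix_const`: the flavour-diagonal Wilson–Dirac matrix is affine in a common
  bare mass, `D(U, m + μ) = D(U, m) + μ·1`; hence (§2, `det_diracMatrix_const`) for `μ ≠ 0`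
  `det D(U, μ) = μ^n · det(1 + μ⁻¹ D(U, 0))`, `n = #`quark variables, and (`norm_det_one_add_inv_smul_diracMatrix_sub_one_lt`)
  **`det(1 + μ⁻¹ D(U, 0)) → 1` as `μ → ∞` UNIFORMLY in the gauge field `U`** (joint continuity on `ℝ × SU(3)^{edges}`,
  compact configuration space, Heine–Cantor: Mathlib `Continuous.tendstoUniformly`) — the zeroth order of the hopping
  expansion of `log det`, uniformly in the background;
* §3 `qcdTorusExpect_gluonic_eq_div`: by the tree's Gaussian Berezin formula (`fermiIntegral_fermiBoltzmann`,
  Montvay–Münster (4.17)) the honest functional of a gluonic insertion `U ↦ g(U)·1` is the `det D`-reweighted Wilson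
  average `∫ g det D dμ_W / ∫ det D dμ_W` (the orientation sign cancels), and at a common bare mass `μ ≠ 0` the factor
  `μ^n` cancels too (`qcdTorusExpect_gluonic_const_eq_div`);
* §4 `tendsto_div_integral_of_tendsto_one`: the analytic core — for a probability measure `P`, a bounded measurable
  `g` and uniformly bounded measurable weights `w_i → 1` pointwise, `(∫ g w_i dP)/(∫ w_i dP) → ∫ g dP` (dominated
  convergence, Mathlib `tendsto_integral_filter_of_norm_le_const`, and `Tendsto.div`);
* §5 THE QUENCHED LIMIT `tendsto_qcdTorusExpect_gluonic_atTop`: for every bounded measurable `g`,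
  `qcdTorusExpect β S (μ, …, μ) (g·1) → ∫ g dμ_W(β)` as `μ → +∞`; its connected two-insertion form; and, in the
  currency of the stub (`qcdLatticeConnectedCorr` on `QCDLatticeObservable`s) and of the Yang–Mills side
  (`latticeConnectedCorr` of `YangMillsOS.lean`), the registered sub-goal
  `tendsto_qcdLatticeConnectedCorr_gluonic_atTop`: for quark-free observables `A = a·1`, `B = b·1` the connected
  Euclidean-time correlation of lattice QCD at `(β, S, μ)` tends, as `μ → +∞`, to the pure-gauge connected correlation
  `latticeConnectedCorr (fundamentalRep (Fin 3)) β S a b n` — EXACTLY the quantity bounded by the Yang–Mills lattice gap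
  clause `HasLatticeMassGap` at coupling `β`.

How the stub would use it (NOT proved here): massiveness of the ray `μ ≥ μ_h(k)` at `β_k` needs (i) clustering of
`latticeConnectedCorr (fundamentalRep (Fin 3)) (β_k) (2S+1) a b n` uniformly in `S` (lattice Yang–Mills gap at the
fixed weak coupling `β_k`; no ledger item states it at fixed `β` — the Yang–Mills statement's `HasLatticeMassGap` is
along a scheme), (ii) a hopping/polymer expansion around `μ = ∞` converging uniformly in `S` that transports (i) to all
`μ ≥ μ₀(β_k)` and to observables with quark content, (iii) the window `[μ_h(k), μ₀(β_k)]`, which is the threshold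
construction's own regime.  This file supplies the `S`-wise end point `μ = ∞` of (ii) only.

References (text, not tags): I. Montvay, G. Münster, *Quantum Fields on a Lattice* (CUP 1994) §4.1 (4.17), §5.1.2
pp. 228–230 (quenched approximation = `K → 0` in the determinant, (5.25)–(5.26)), §5.1.3 (hopping expansion), §3.7.1
p. 163 (Osterwalder–Seiler theorem); K. Osterwalder, E. Seiler, Ann. Phys. 110 (1978) 440; E. Seiler, LNP 159
(Springer 1982); H. Meyer-Ortmanns, T. Reisz, *Principles of Phase Structures in Particle Physics* (World Scientific
2006) §4.1.3 pp. 301–303, §4.1.5 pp. 306–311.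
-/

noncomputable section

namespace Summit.QuantumFields.QCD.Theorems.HonestHeavyAnchorQuenchedLimit

open MeasureTheory Filter Topology
open Literature.MathematicalPhysics.QuantumLattice Literature.MathematicalPhysics.QuantumFieldTheory
open Literature.Probability.LatticeModels (TorusSite)

variable {Nf : ℕ} {S : ℕ} [NeZero S]

/-! ## §1 The Wilson–Dirac matrix is affine in a common bare mass -/

/-- Entrywise: `D_W(U, m + μ, r)_{pq} = D_W(U, m, r)_{pq} + μ δ_{pq}` (the bare mass enters the Wilson–Dirac operator
only through the diagonal term `(m + 4r) δ`). [folklore] -/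
theorem wilsonDirac_apply_mass_add {L N : ℕ} {G : Type*} [Group G] (ρ : G →* Matrix (Fin N) (Fin N) ℂ)
    (U : GaugeConfig 4 L G) (m μ r : ℝ) (p q : TorusSite 4 L × Fin N × Fin 4) :
    wilsonDirac ρ U (m + μ) r p q = wilsonDirac ρ U m r p q + if p = q then (μ : ℂ) else 0 := by
  simp only [wilsonDirac, Matrix.of_apply]
  split_ifs <;> push_cast <;> ring

/-- `D_W(U, m + μ, r) = D_W(U, m, r) + μ · 1`. [folklore] -/
theorem wilsonDirac_mass_add {L N : ℕ} {G : Type*} [Group G] (ρ : G →* Matrix (Fin N) (Fin N) ℂ)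
    (U : GaugeConfig 4 L G) (m μ r : ℝ) :
    wilsonDirac ρ U (m + μ) r = wilsonDirac ρ U m r + (μ : ℂ) • (1 : Matrix _ _ ℂ) := by
  ext p q
  rw [wilsonDirac_apply_mass_add, Matrix.add_apply, Matrix.smul_apply, Matrix.one_apply, smul_eq_mul,
    mul_ite, mul_one, mul_zero]

/-- **The `N_f`-flavour Wilson–Dirac matrix is affine in a common mass shift**:
`D(U, m + μ) = D(U, m) + μ · 1` (flavour-diagonal blocks `D_W(U, m_f + μ, 1)`). [folklore] -/
theorem diracMatrix_mass_add (U : GaugeConfig 4 S SU3) (mq : Fin Nf → ℝ) (μ : ℝ) :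
    diracMatrix U (fun f => mq f + μ) = diracMatrix U mq + (μ : ℂ) • (1 : Matrix _ _ ℂ) := by
  ext i j
  have hij : i = j ↔ quarkEquiv.symm i = quarkEquiv.symm j := quarkEquiv.symm.injective.eq_iff.symm
  simp only [diracMatrix, Matrix.reindex_apply, Matrix.submatrix_apply, Matrix.of_apply, Matrix.add_apply,
    Matrix.smul_apply, Matrix.one_apply, smul_eq_mul, mul_ite, mul_one, mul_zero, wilsonDirac_mass_add]
  by_cases h1 : (quarkEquiv.symm i).1 = (quarkEquiv.symm j).1
  · by_cases h2 : (quarkEquiv.symm i).2 = (quarkEquiv.symm j).2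
    · have h : i = j := hij.2 (Prod.ext h1 h2)
      simp [h]
    · have h : i ≠ j := fun h => h2 (by rw [h])
      simp [h1, h2, h]
  · have h : i ≠ j := fun h => h1 (by rw [h])
    simp [h1, h]

/-- At a common (degenerate) bare mass `μ`: `D(U, μ) = D(U, 0) + μ · 1`, with `D(U, 0)` the massless Wilson–Dirac
matrix (the `μ`-independent hopping-plus-Wilson part). [folklore] -/
theorem diracMatrix_const (U : GaugeConfig 4 S SU3) (μ : ℝ) :
    diracMatrix U (fun _ : Fin Nf => μ) =
      diracMatrix U (fun _ : Fin Nf => 0) + (μ : ℂ) • (1 : Matrix _ _ ℂ) := by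
  rw [← diracMatrix_mass_add]
  simp only [zero_add]

/-! ## §2 The fermion determinant at large common mass, uniformly in the gauge field -/

/-- **`det D(U, μ) = μ^n · det(1 + μ⁻¹ D(U, 0))`** for `μ ≠ 0`, `n` the number of quark variables of the torus
(pull the scalar `μ` out of every row). [folklore] -/
theorem det_diracMatrix_const (U : GaugeConfig 4 S SU3) {μ : ℝ} (hμ : μ ≠ 0) :
    (diracMatrix U (fun _ : Fin Nf => μ)).det =
      (μ : ℂ) ^ Fintype.card (FermiIdx Nf S) *
        ((1 : Matrix (FermiIdx Nf S) (FermiIdx Nf S) ℂ) + (μ : ℂ)⁻¹ • diracMatrix U (fun _ : Fin Nf => (0 : ℝ))).det := by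
  have hμ' : (μ : ℂ) ≠ 0 := Complex.ofReal_ne_zero.2 hμ
  rw [diracMatrix_const, ← Matrix.det_smul, smul_add, smul_smul, mul_inv_cancel₀ hμ', one_smul, add_comm]

/-- The normalised determinant `(t, U) ↦ det(1 + t · D(U, 0))` is jointly continuous on `ℝ × SU(3)^{edges}` (a
polynomial in `t` and the link-matrix entries). [folklore] -/
theorem continuous_det_one_add_smul_diracMatrix :
    Continuous fun p : ℝ × GaugeConfig 4 S SU3 =>
      ((1 : Matrix (FermiIdx Nf S) (FermiIdx Nf S) ℂ) + (p.1 : ℂ) • diracMatrix p.2 (fun _ : Fin Nf => (0 : ℝ))).det :=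
  (continuous_const.add ((Complex.continuous_ofReal.comp continuous_fst).smul
    ((continuous_diracMatrix (S := S) (fun _ : Fin Nf => (0 : ℝ))).comp continuous_snd))).matrix_det

/-- At fixed `t`, `U ↦ det(1 + t · D(U, 0))` is continuous in the gauge field. [folklore] -/
theorem continuous_det_one_add_const_smul_diracMatrix (t : ℂ) :
    Continuous fun U : GaugeConfig 4 S SU3 =>
      ((1 : Matrix (FermiIdx Nf S) (FermiIdx Nf S) ℂ) + t • diracMatrix U (fun _ : Fin Nf => (0 : ℝ))).det :=
  (continuous_const.add ((continuous_diracMatrix (S := S) (fun _ : Fin Nf => (0 : ℝ))).const_smul t)).matrix_det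

/-- **`det(1 + t · D(U, 0)) → 1` as `t → 0`, UNIFORMLY in `U`**: the configuration space `SU(3)^{edges}` of the finite
torus is compact and the normalised determinant is jointly continuous, so Heine–Cantor applies (Mathlib
`Continuous.tendstoUniformly`). [folklore] -/
theorem tendstoUniformly_det_one_add_smul_diracMatrix :
    TendstoUniformly (fun (t : ℝ) (U : GaugeConfig 4 S SU3) =>
        ((1 : Matrix (FermiIdx Nf S) (FermiIdx Nf S) ℂ) + (t : ℂ) • diracMatrix U (fun _ : Fin Nf => (0 : ℝ))).det)
      (fun _ => 1) (𝓝 (0 : ℝ)) := by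
  have h := Continuous.tendstoUniformly (fun (t : ℝ) (U : GaugeConfig 4 S SU3) =>
        ((1 : Matrix (FermiIdx Nf S) (FermiIdx Nf S) ℂ) + (t : ℂ) • diracMatrix U (fun _ : Fin Nf => (0 : ℝ))).det)
    (continuous_det_one_add_smul_diracMatrix (Nf := Nf) (S := S)) 0
  convert h using 1
  funext U
  simp only [Complex.ofReal_zero, zero_smul, add_zero, Matrix.det_one]

/-- **The normalised fermion determinant tends to `1` as the common bare mass `μ → +∞`, uniformly in the gauge
field**: `∀ ε > 0`, for all large `μ` and ALL `U`, `‖det(1 + μ⁻¹ D(U, 0)) − 1‖ < ε` (the zeroth order of the hopping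
expansion `det D(U, μ)/μ^n = exp tr log(1 + μ⁻¹ D(U,0))`, uniformly in the background). [folklore] -/
theorem norm_det_one_add_inv_smul_diracMatrix_sub_one_lt :
    ∀ ε > (0 : ℝ), ∀ᶠ μ : ℝ in atTop, ∀ U : GaugeConfig 4 S SU3,
      ‖((1 : Matrix (FermiIdx Nf S) (FermiIdx Nf S) ℂ) +
          (μ : ℂ)⁻¹ • diracMatrix U (fun _ : Fin Nf => (0 : ℝ))).det - 1‖ < ε := by
  have hU := tendstoUniformly_det_one_add_smul_diracMatrix (Nf := Nf) (S := S)
  rw [Metric.tendstoUniformly_iff] at hU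
  intro ε hε
  filter_upwards [tendsto_inv_atTop_zero.eventually (hU ε hε)] with μ hμ U
  have h := hμ U
  rw [dist_comm, dist_eq_norm, Complex.ofReal_inv] at h
  exact h

/-- Pointwise form: for every gauge field `U`, `det(1 + μ⁻¹ D(U, 0)) → 1` as `μ → +∞`. [folklore] -/
theorem tendsto_det_one_add_inv_smul_diracMatrix (U : GaugeConfig 4 S SU3) :
    Tendsto (fun μ : ℝ => ((1 : Matrix (FermiIdx Nf S) (FermiIdx Nf S) ℂ) +
        (μ : ℂ)⁻¹ • diracMatrix U (fun _ : Fin Nf => (0 : ℝ))).det) atTop (𝓝 1) := by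
  refine Metric.tendsto_nhds.2 fun ε hε => ?_
  filter_upwards [norm_det_one_add_inv_smul_diracMatrix_sub_one_lt (Nf := Nf) (S := S) ε hε] with μ hμ
  rw [dist_eq_norm]
  exact hμ U

/-- Eventually (in `μ → +∞`) the normalised determinant is bounded by `2`, uniformly in `U`. [folklore] -/
theorem norm_det_one_add_inv_smul_diracMatrix_le_two :
    ∀ᶠ μ : ℝ in atTop, ∀ U : GaugeConfig 4 S SU3,
      ‖((1 : Matrix (FermiIdx Nf S) (FermiIdx Nf S) ℂ) +
          (μ : ℂ)⁻¹ • diracMatrix U (fun _ : Fin Nf => (0 : ℝ))).det‖ ≤ 2 := by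
  filter_upwards [norm_det_one_add_inv_smul_diracMatrix_sub_one_lt (Nf := Nf) (S := S) 1 one_pos] with μ hμ U
  have h := hμ U
  have h2 := norm_le_norm_add_norm_sub' ((1 : Matrix (FermiIdx Nf S) (FermiIdx Nf S) ℂ) +
    (μ : ℂ)⁻¹ • diracMatrix U (fun _ : Fin Nf => (0 : ℝ))).det (1 : ℂ)
  rw [norm_one] at h2
  linarith

/-! ## §3 Berezin bookkeeping: gluonic insertions see the signed determinant weight -/

/-- Scalars pass through the Berezin integral: `∫dψ̄dψ (c·1) y = c ∫dψ̄dψ y`. [folklore] -/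
theorem fermiIntegral_algebraMap_mul (c : ℂ) (y : FermiAlg Nf S) :
    fermiIntegral (algebraMap ℂ (FermiAlg Nf S) c * y) = c * fermiIntegral y := by
  rw [← Algebra.smul_def, map_smul, smul_eq_mul]

/-- **The honest functional of a gluonic insertion is the `det D`-reweighted Wilson average**:
`⟨g·1⟩_{β,S,m} = ∫ g det D(·, m) dμ_W / ∫ det D(·, m) dμ_W` — Gaussian Berezin integral in every background (tree
`fermiIntegral_fermiBoltzmann`, Montvay–Münster (4.17)); the orientation sign `(−1)^{n(n−1)/2+n}` cancels between
numerator and denominator. [folklore] -/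
theorem qcdTorusExpect_gluonic_eq_div (β : ℝ) (mq : Fin Nf → ℝ) (g : GaugeConfig 4 S SU3 → ℂ) :
    qcdTorusExpect β S mq (fun U => algebraMap ℂ (FermiAlg Nf S) (g U)) =
      (∫ U, g U * (diracMatrix U mq).det ∂(wilsonMeasure (d := 4) (L := S) (fundamentalRep (Fin 3)) β)) /
        ∫ U, (diracMatrix U mq).det ∂(wilsonMeasure (d := 4) (L := S) (fundamentalRep (Fin 3)) β) := by
  have hε := fermiOrientationSign_ne_zero
    (Fintype.card (FermiIdx Nf S) * (Fintype.card (FermiIdx Nf S) - 1) / 2 + Fintype.card (FermiIdx Nf S))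
  unfold qcdTorusExpect
  simp_rw [fermiIntegral_algebraMap_mul, fermiIntegral_fermiBoltzmann]
  simp_rw [mul_left_comm (g _), integral_const_mul]
  rw [mul_div_mul_left _ _ hε]

/-- At a common bare mass `μ ≠ 0` the factor `μ^n` cancels as well:
`⟨g·1⟩_{β,S,(μ,…,μ)} = ∫ g w_μ dμ_W / ∫ w_μ dμ_W` with the NORMALISED weight `w_μ(U) = det(1 + μ⁻¹ D(U, 0))`. [folklore] -/
theorem qcdTorusExpect_gluonic_const_eq_div (β : ℝ) {μ : ℝ} (hμ : μ ≠ 0) (g : GaugeConfig 4 S SU3 → ℂ) :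
    qcdTorusExpect β S (fun _ : Fin Nf => μ) (fun U => algebraMap ℂ (FermiAlg Nf S) (g U)) =
      (∫ U, g U * ((1 : Matrix (FermiIdx Nf S) (FermiIdx Nf S) ℂ) +
            (μ : ℂ)⁻¹ • diracMatrix U (fun _ : Fin Nf => (0 : ℝ))).det
          ∂(wilsonMeasure (d := 4) (L := S) (fundamentalRep (Fin 3)) β)) /
        ∫ U, ((1 : Matrix (FermiIdx Nf S) (FermiIdx Nf S) ℂ) +
            (μ : ℂ)⁻¹ • diracMatrix U (fun _ : Fin Nf => (0 : ℝ))).det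
          ∂(wilsonMeasure (d := 4) (L := S) (fundamentalRep (Fin 3)) β) := by
  have hμN : (μ : ℂ) ^ Fintype.card (FermiIdx Nf S) ≠ 0 := pow_ne_zero _ (Complex.ofReal_ne_zero.2 hμ)
  rw [qcdTorusExpect_gluonic_eq_div]
  simp_rw [det_diracMatrix_const _ hμ, mul_left_comm (g _), integral_const_mul]
  rw [mul_div_mul_left _ _ hμN]

/-! ## §4 The analytic core: normalised averages with weights tending to one -/

/-- **Reweighted averages with weights tending to `1`.** For a probability measure `P`, a bounded (a.e.-strongly)
measurable `g : α → ℂ`, and weights `w_i : α → ℂ` that are eventually measurable and uniformly bounded and tend to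
`1` pointwise along a countably generated filter `l`, `(∫ g w_i dP)/(∫ w_i dP) → ∫ g dP` (dominated convergence for
numerator and denominator, then continuity of division at denominator `1`). [folklore] -/
theorem tendsto_div_integral_of_tendsto_one {α ι : Type*} [MeasurableSpace α] (P : Measure α)
    [IsProbabilityMeasure P] (l : Filter ι) [l.IsCountablyGenerated] (w : ι → α → ℂ) (g : α → ℂ) (C B : ℝ)
    (hgm : AEStronglyMeasurable g P) (hgC : ∀ x, ‖g x‖ ≤ C)
    (hwm : ∀ᶠ i in l, AEStronglyMeasurable (w i) P) (hwB : ∀ᶠ i in l, ∀ x, ‖w i x‖ ≤ B)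
    (hw : ∀ x, Tendsto (fun i => w i x) l (𝓝 1)) :
    Tendsto (fun i => (∫ x, g x * w i x ∂P) / ∫ x, w i x ∂P) l (𝓝 (∫ x, g x ∂P)) := by
  have hnum : Tendsto (fun i => ∫ x, g x * w i x ∂P) l (𝓝 (∫ x, g x ∂P)) := by
    refine tendsto_integral_filter_of_norm_le_const (μ := P) (l := l) (F := fun i x => g x * w i x) (f := g)
      ?_ ⟨C * B, ?_⟩ ?_
    · filter_upwards [hwm] with i hi using hgm.mul hi
    · filter_upwards [hwB] with i hi
      exact Eventually.of_forall fun x => by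
        rw [norm_mul]
        exact mul_le_mul (hgC x) (hi x) (norm_nonneg _) ((norm_nonneg _).trans (hgC x))
    · exact Eventually.of_forall fun x => by simpa using (tendsto_const_nhds (x := g x)).mul (hw x)
  have hden : Tendsto (fun i => ∫ x, w i x ∂P) l (𝓝 1) := by
    have h := tendsto_integral_filter_of_norm_le_const (μ := P) (l := l) (F := w) (f := fun _ => (1 : ℂ))
      hwm ⟨B, ?_⟩ (Eventually.of_forall hw)
    · simpa using h
    · filter_upwards [hwB] with i hi using Eventually.of_forall hi
  have h := hnum.div hden one_ne_zero
  rw [div_one] at h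
  exact h

/-! ## §5 The quenched limit `μ → +∞` at fixed `(β, S)` -/

/-- **QUENCHED LIMIT of the honest lattice-QCD torus functional on gluonic insertions.** For every torus side `S`,
inverse coupling `β`, and bounded measurable `g : SU(3)^{edges} → ℂ`, the honest signed functional at the degenerate
bare masses `(μ, …, μ)` of the insertion `g·1` tends to the pure-gauge Wilson expectation as `μ → +∞`:
`qcdTorusExpect β S (μ,…,μ) (g·1) → ∫ g dμ_W(β)` (Montvay–Münster §5.1.2, (5.25)–(5.26): the quenched approximation
"is equivalent to take the zero hopping parameter limit in the quark determinant … infinitely heavy static quarks";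
here as a theorem at fixed volume, for the tree's signed functional). [folklore] -/
theorem tendsto_qcdTorusExpect_gluonic_atTop :
    ∀ (Nf S : ℕ) [NeZero S] (β C : ℝ) (g : GaugeConfig 4 S SU3 → ℂ),
    AEStronglyMeasurable g (wilsonMeasure (d := 4) (L := S) (fundamentalRep (Fin 3)) β) →
    (∀ U, ‖g U‖ ≤ C) →
    Tendsto (fun μ : ℝ => qcdTorusExpect β S (fun _ : Fin Nf => μ) (fun U => algebraMap ℂ (FermiAlg Nf S) (g U)))
      atTop (𝓝 (∫ U, g U ∂(wilsonMeasure (d := 4) (L := S) (fundamentalRep (Fin 3)) β))) := by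
  intro Nf S _ β C g hgm hgC
  have key := tendsto_div_integral_of_tendsto_one (wilsonMeasure (d := 4) (L := S) (fundamentalRep (Fin 3)) β)
    atTop (fun (μ : ℝ) (U : GaugeConfig 4 S SU3) => ((1 : Matrix (FermiIdx Nf S) (FermiIdx Nf S) ℂ) +
      (μ : ℂ)⁻¹ • diracMatrix U (fun _ : Fin Nf => (0 : ℝ))).det) g C 2 hgm hgC
    (Eventually.of_forall fun μ =>
      (continuous_det_one_add_const_smul_diracMatrix (Nf := Nf) (S := S) ((μ : ℂ)⁻¹)).aestronglyMeasurable)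
    (norm_det_one_add_inv_smul_diracMatrix_le_two (Nf := Nf) (S := S))
    (tendsto_det_one_add_inv_smul_diracMatrix (Nf := Nf) (S := S))
  refine key.congr' ?_
  filter_upwards [eventually_ne_atTop 0] with μ hμ
  exact (qcdTorusExpect_gluonic_const_eq_div β hμ g).symm

/-- **Quenched limit of connected gluonic two-insertion correlations**: for bounded measurable `g₁, g₂`,
`⟨g₁ g₂·1⟩ − ⟨g₁·1⟩⟨g₂·1⟩ → ∫ g₁ g₂ dμ_W − ∫ g₁ dμ_W ∫ g₂ dμ_W` as the common bare mass `μ → +∞`. [folklore] -/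
theorem tendsto_qcdTorusExpect_gluonic_connected_atTop (β C₁ C₂ : ℝ) (g₁ g₂ : GaugeConfig 4 S SU3 → ℂ)
    (h₁m : AEStronglyMeasurable g₁ (wilsonMeasure (d := 4) (L := S) (fundamentalRep (Fin 3)) β))
    (h₂m : AEStronglyMeasurable g₂ (wilsonMeasure (d := 4) (L := S) (fundamentalRep (Fin 3)) β))
    (h₁C : ∀ U, ‖g₁ U‖ ≤ C₁) (h₂C : ∀ U, ‖g₂ U‖ ≤ C₂) :
    Tendsto (fun μ : ℝ =>
        qcdTorusExpect β S (fun _ : Fin Nf => μ)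
            (fun U => algebraMap ℂ (FermiAlg Nf S) (g₁ U) * algebraMap ℂ (FermiAlg Nf S) (g₂ U)) -
          qcdTorusExpect β S (fun _ : Fin Nf => μ) (fun U => algebraMap ℂ (FermiAlg Nf S) (g₁ U)) *
            qcdTorusExpect β S (fun _ : Fin Nf => μ) (fun U => algebraMap ℂ (FermiAlg Nf S) (g₂ U)))
      atTop (𝓝 ((∫ U, g₁ U * g₂ U ∂(wilsonMeasure (d := 4) (L := S) (fundamentalRep (Fin 3)) β)) -
        (∫ U, g₁ U ∂(wilsonMeasure (d := 4) (L := S) (fundamentalRep (Fin 3)) β)) *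
          ∫ U, g₂ U ∂(wilsonMeasure (d := 4) (L := S) (fundamentalRep (Fin 3)) β))) := by
  have h12 := tendsto_qcdTorusExpect_gluonic_atTop Nf S β (C₁ * C₂) (fun U => g₁ U * g₂ U) (h₁m.mul h₂m)
    (fun U => by rw [norm_mul]; exact mul_le_mul (h₁C U) (h₂C U) (norm_nonneg _) ((norm_nonneg _).trans (h₁C U)))
  have h1 := tendsto_qcdTorusExpect_gluonic_atTop Nf S β C₁ g₁ h₁m h₁C
  have h2 := tendsto_qcdTorusExpect_gluonic_atTop Nf S β C₂ g₂ h₂m h₂C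
  simp_rw [← map_mul]
  exact h12.sub (h1.mul h2)

/-! ### In the currency of the stub: quark-free `QCDLatticeObservable`s and the Yang–Mills connected correlation -/

/-- A quark-free ("gluonic") local observable `A = a·1` placed at `v` on the torus is the scalar `a` read on the
translated periodic lift: `A.onTorus S v = (U ↦ a(τ_{−v} Ũ)·1)` (algebra maps fix scalars). [folklore] -/
theorem onTorus_eq_algebraMap {R : ℕ} (A : QCDLatticeObservable Nf R) (a : LGConfig 4 SU3 → ℂ)
    (hA : ∀ V, A.F V = algebraMap ℂ (BoxFermiAlg Nf R) (a V)) (S : ℕ) [NeZero S]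
    (v : Literature.Probability.LatticeModels.Site 4) :
    A.onTorus S v = fun U : GaugeConfig 4 S SU3 =>
      algebraMap ℂ (FermiAlg Nf S) (a (configShift (-v) (torusLift S U))) := by
  funext U
  simp only [QCDLatticeObservable.onTorus, hA, AlgHom.commutes]

/-- The scalar part `a` of a quark-free observable `A = a·1` is bounded (the boundedness clause of
`QCDLatticeObservable`, tested against the top monomial, whose Berezin integral is `1`). [folklore] -/
theorem exists_norm_le_of_gluonic {R : ℕ} (A : QCDLatticeObservable Nf R) (a : LGConfig 4 SU3 → ℂ)
    (hA : ∀ V, A.F V = algebraMap ℂ (BoxFermiAlg Nf R) (a V)) : ∃ C : ℝ, ∀ V, ‖a V‖ ≤ C := by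
  obtain ⟨C, hC⟩ := A.bounded (GrassmannAlgebra.grassmannBasis ℂ (BoxFermiIdx Nf R ⊕ₗ BoxFermiIdx Nf R) Finset.univ)
  refine ⟨C, fun V => ?_⟩
  have h := hC V
  rwa [hA, ← Algebra.smul_def, map_smul, GrassmannAlgebra.berezin_grassmannBasis_univ, smul_eq_mul, mul_one] at h

/-- The scalar part `a` of a quark-free observable `A = a·1` is measurable (the measurability clause of
`QCDLatticeObservable`, tested against the top monomial). [folklore] -/
theorem measurable_of_gluonic {R : ℕ} (A : QCDLatticeObservable Nf R) (a : LGConfig 4 SU3 → ℂ)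
    (hA : ∀ V, A.F V = algebraMap ℂ (BoxFermiAlg Nf R) (a V)) : Measurable a := by
  have h := A.measurable (GrassmannAlgebra.grassmannBasis ℂ (BoxFermiIdx Nf R ⊕ₗ BoxFermiIdx Nf R) Finset.univ)
  have hfun : (fun V => GrassmannAlgebra.berezin ℂ (BoxFermiIdx Nf R ⊕ₗ BoxFermiIdx Nf R)
      (A.F V * GrassmannAlgebra.grassmannBasis ℂ (BoxFermiIdx Nf R ⊕ₗ BoxFermiIdx Nf R) Finset.univ)) = a := by
    funext V
    rw [hA, ← Algebra.smul_def, map_smul, GrassmannAlgebra.berezin_grassmannBasis_univ, smul_eq_mul, mul_one]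
  rw [hfun] at h
  exact h

/-- The un-translated placement: `τ_{−0} Ũ = Ũ`. [folklore] -/
theorem configShift_neg_zero (V : LGConfig 4 SU3) :
    configShift (-(0 : Literature.Probability.LatticeModels.Site 4)) V = V := by
  funext e
  rw [neg_zero, Literature.MathematicalPhysics.QuantumLattice.configShift_apply, sub_zero]

/-- The pure-gauge connected correlation of `YangMillsOS.lean`, cast to `ℂ`, written with complex integrands and with
the translated second factor (translation invariance of the torus Wilson state, tree
`integral_comp_configShift_torusLift`). [folklore] -/
theorem ofReal_latticeConnectedCorr (β : ℝ) (S : ℕ) [NeZero S] (a b : LGConfig 4 SU3 → ℝ) (n : ℕ) :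
    ((latticeConnectedCorr (fundamentalRep (Fin 3)) β S a b n : ℝ) : ℂ) =
      (∫ U, ((a (torusLift S U) : ℝ) : ℂ) *
          ((b (configShift (-(Pi.single 0 (n : ℤ) : Literature.Probability.LatticeModels.Site 4)) (torusLift S U)) : ℝ) : ℂ)
          ∂(wilsonMeasure (d := 4) (L := S) (fundamentalRep (Fin 3)) β)) -
        (∫ U, ((a (torusLift S U) : ℝ) : ℂ) ∂(wilsonMeasure (d := 4) (L := S) (fundamentalRep (Fin 3)) β)) *
          ∫ U, ((b (configShift (-(Pi.single 0 (n : ℤ) : Literature.Probability.LatticeModels.Site 4)) (torusLift S U)) : ℝ) : ℂ)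
            ∂(wilsonMeasure (d := 4) (L := S) (fundamentalRep (Fin 3)) β) := by
  unfold latticeConnectedCorr
  rw [← integral_comp_configShift_torusLift (fundamentalRep (Fin 3)) β b
    (-(Pi.single 0 (n : ℤ) : Literature.Probability.LatticeModels.Site 4))]
  simp only [← integral_complex_ofReal, Complex.ofReal_sub, Complex.ofReal_mul]

/-- **QUENCHED LIMIT OF THE STUB'S CURRENCY (registered sub-goal).** For quark-free local observables `A = a·1`,
`B = b·1` (`a, b` real, bounded measurable cylinder functions of the gauge field — all Wilson loops and their
polynomials), the connected Euclidean-time correlation of honest lattice QCD on the torus of side `S` at inverse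
coupling `β` and degenerate bare Wilson masses `(μ, …, μ)` tends, as `μ → +∞`, to the PURE-GAUGE connected correlation
`latticeConnectedCorr (fundamentalRep (Fin 3)) β S a b n` of `YangMillsOS.lean` — the quantity that the Yang–Mills
lattice gap clause `HasLatticeMassGap` bounds at coupling `β`.  This is the `μ = +∞` end of the massive ray of stub U
at fixed `(β, S)`; massiveness of the ray additionally needs fixed-`β` Yang–Mills clustering uniform in `S` and a
volume-uniform expansion around `μ = ∞` (open). [folklore] -/
theorem tendsto_qcdLatticeConnectedCorr_gluonic_atTop :
    ∀ (Nf S R R' : ℕ) [NeZero S] (β : ℝ) (A : QCDLatticeObservable Nf R) (B : QCDLatticeObservable Nf R')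
    (a b : Literature.MathematicalPhysics.QuantumLattice.LGConfig 4 (Matrix.specialUnitaryGroup (Fin 3) ℂ) → ℝ),
    (∀ V, A.F V = algebraMap ℂ (BoxFermiAlg Nf R) ((a V : ℝ) : ℂ)) →
    (∀ V, B.F V = algebraMap ℂ (BoxFermiAlg Nf R') ((b V : ℝ) : ℂ)) →
    ∀ n : ℕ, Tendsto (fun μ : ℝ => qcdLatticeConnectedCorr β S (fun _ : Fin Nf => μ) A B n) atTop
      (𝓝 ((latticeConnectedCorr (Literature.MathematicalPhysics.QuantumLattice.fundamentalRep (Fin 3)) β S a b n : ℝ) : ℂ)) := by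
  intro Nf S R R' _ β A B a b hA hB n
  obtain ⟨Ca, hCa⟩ := exists_norm_le_of_gluonic A (fun V => ((a V : ℝ) : ℂ)) hA
  obtain ⟨Cb, hCb⟩ := exists_norm_le_of_gluonic B (fun V => ((b V : ℝ) : ℂ)) hB
  have hma := measurable_of_gluonic A (fun V => ((a V : ℝ) : ℂ)) hA
  have hmb := measurable_of_gluonic B (fun V => ((b V : ℝ) : ℂ)) hB
  have hτ : Measurable fun U : GaugeConfig 4 S SU3 =>
      configShift (-(Pi.single 0 (n : ℤ) : Literature.Probability.LatticeModels.Site 4)) (torusLift S U) :=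
    (configShift _).measurable.comp (measurable_torusLift S)
  have h := tendsto_qcdTorusExpect_gluonic_connected_atTop (Nf := Nf) (S := S) β Ca Cb
    (fun U => ((a (torusLift S U) : ℝ) : ℂ))
    (fun U => ((b (configShift (-(Pi.single 0 (n : ℤ) : Literature.Probability.LatticeModels.Site 4))
      (torusLift S U)) : ℝ) : ℂ))
    (hma.comp (measurable_torusLift S)).aestronglyMeasurable (hmb.comp hτ).aestronglyMeasurable
    (fun U => hCa _) (fun U => hCb _)
  have hA' : A.onTorus S 0 = fun U : GaugeConfig 4 S SU3 =>
      algebraMap ℂ (FermiAlg Nf S) ((a (torusLift S U) : ℝ) : ℂ) := by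
    rw [onTorus_eq_algebraMap A _ hA]
    funext U
    rw [configShift_neg_zero]
  have hB' := onTorus_eq_algebraMap B _ hB S (Pi.single 0 (n : ℤ))
  rw [ofReal_latticeConnectedCorr]
  simp only [qcdLatticeConnectedCorr, hA', hB']
  exact h

end Summit.QuantumFields.QCD.Theorems.HonestHeavyAnchorQuenchedLimit

end
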